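import Literature.NumberTheory.EllipticCurves.ManinConstantSemistableTwistSharpProofs
import HarnessLib

/-!
# The formal parameter of a curve with a short-model parametrisation package (Step 4 of the tree's Edixhoven
# programme, in isolation and lattice-free) (route `ManinLocalTwoThree`, cruxes C2 stmt-BirchSwinnertonDyer-22967 /
# C3 stmt-…-22968; cell bsd-f2-manin, prover p2 gen 25; CES-discharge programme, stage 3 step (2a))

The tree's `exists_formalParam_of_neronLattice_eq_smul_periodLattice` (`ManinConstantSemistableTwistSharpProofs`) packs
Steps 1–4 of the Edixhoven formal-group programme for the data of the fact
`edixhoven_int_of_neronLattice_eq_smul_periodLattice` (`Λ_{L'} = q·Λ₀(f)`).  Its Step 4 is lattice-free: from a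
SHORT-MODEL PARAMETRISATION PACKAGE of a curve `W'/ℚ` — an elliptic `E/ℚ`, an admissible change of variables `vc` with
`vc • E = W'`, and a series `z ∈ qℚ⟦q⟧` with `log_E(z) = Σ aₙ(W')qⁿ/n` whose coordinates `z`, `w_E(z)` have bounded
denominators — it produces the FORMAL PARAMETER `t₀ = θ_vc(z)` of `W'`: `[X¹]t₀ = u(vc)`, `log_{W'}(t₀) = u·Σ aₙ(W')qⁿ/n`,
`t₀, w_{W'}(t₀) ∈ Frac ℤ⟦q⟧`.  We record exactly this step:

* `exists_formalParam_of_shortModelParam`.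

It is the interface between the lattice side (where `E, z, vc` come from: `Λ₀(f)` in the tree's files, `Λ₁(f)` in
`…StevensShortModelParam`) and the tree's abstract local cores `padicNorm_le_one_of_formalLog_subst_eq_of_semistableTwist(_vertex|_sharp)`.
Fact-free; standard axioms; no definitions.  BSD is not proved by this file; Manin's conjecture, C2 and C3 are not proved by this file.
[cite: EdixhovenManin1991, Prop. 2] [cite: SilvermanAEC2009, IV.1, IV.5.5] [cite: Honda1970, §6.2 (pp. 241–242)]
-/

set_option autoImplicit false
-- lint-debt: the directory name repeats the summit name (sibling precedent `ManinLocalTwoThreeStevensCurveDatum.lean`)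
set_option linter.dupNamespace false

noncomputable section

open PowerSeries
open WeierstrassCurve Literature.NumberTheory.EllipticCurves

namespace Summit.BirchSwinnertonDyer.BirchSwinnertonDyer.Theorems.ManinLocalTwoThree.StevensIntegrality

/-- **The formal parameter `t₀ = θ_vc(z)` of `W'` from a short-model parametrisation package** (Step 4 of the tree's
Edixhoven programme, lattice-free): for an elliptic `E/ℚ`, `vc • E = W'`, and `z ∈ qℚ⟦q⟧` with
`log_E(z) = Σ aₙ(W')qⁿ/n`, `z·Q = P`, `w_E(z)·Q₂ = P₂` (`P, Q, P₂, Q₂ ∈ ℤ⟦q⟧`, `Q, Q₂ ≠ 0`), the series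
`t₀ = θ_vc(z)` satisfies `t₀(0) = 0`, `[X¹]t₀ = u(vc)`, `log_{W'}(t₀) = u(vc)·Σ aₙ(W')qⁿ/n`, and `t₀`, `w_{W'}(t₀)` have bounded
denominators. [cite: SilvermanAEC2009, IV.1, IV.5.5] [cite: EdixhovenManin1991, Prop. 2] -/
theorem exists_formalParam_of_shortModelParam {W' E : WeierstrassCurve ℚ} [W'.IsElliptic] [E.IsElliptic]
    {z : ℚ⟦X⟧} {P Q P₂ Q₂ : ℤ⟦X⟧} (hz0 : constantCoeff z = 0) (hQ : Q ≠ 0)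
    (hPQ : z * Q.map (Int.castRingHom ℚ) = P.map (Int.castRingHom ℚ)) (hQ₂ : Q₂ ≠ 0)
    (hPQ₂ : E.formalW.subst z * Q₂.map (Int.castRingHom ℚ) = P₂.map (Int.castRingHom ℚ))
    (hlog : E.formalLog.subst z = PowerSeries.mk fun n ↦ ((W'.LFunction n : ℤ) : ℚ) / n)
    {vc : VariableChange ℚ} (hC : vc • E = W') :
    ∃ t₀ : ℚ⟦X⟧, constantCoeff t₀ = 0 ∧ coeff 1 t₀ = (vc.u : ℚ) ∧
      W'.formalLog.subst t₀ = C (vc.u : ℚ) * (PowerSeries.mk fun n ↦ ((W'.LFunction n : ℤ) : ℚ) / n) ∧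
      ∃ P' Q' P₂' Q₂' : ℤ⟦X⟧, Q' ≠ 0 ∧ t₀ * Q'.map (Int.castRingHom ℚ) = P'.map (Int.castRingHom ℚ) ∧
        Q₂' ≠ 0 ∧ W'.formalW.subst t₀ * Q₂'.map (Int.castRingHom ℚ) = P₂'.map (Int.castRingHom ℚ) := by
  have hz1 : coeff 1 z = 1 := by
    have h1 := congrArg (coeff 1) hlog
    rwa [coeff_one_subst_eq_mul _ hz0, coeff_one_formalLog, one_mul, coeff_mk, Nat.cast_one,
      div_one, W'.isMultiplicative_LFunction.map_one, Int.cast_one] at h1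
  set t₀ : ℚ⟦X⟧ := (E.formalVariableChange vc).subst z with ht₀
  have ht₀0 : constantCoeff t₀ = 0 :=
    (constantCoeff_subst_eq_constantCoeff hz0).trans (E.constantCoeff_formalVariableChange vc)
  have ht₀1 : coeff 1 t₀ = (vc.u : ℚ) := by
    rw [ht₀, E.coeff_one_formalVariableChange_subst vc hz0, hz1, mul_one]
  have hlog₀ : W'.formalLog.subst t₀ = C (vc.u : ℚ) * PowerSeries.mk fun n ↦ ((W'.LFunction n : ℤ) : ℚ) / n := by
    rw [ht₀, ← hlog, ← hC]
    exact E.formalLog_subst_formalVariableChange_subst vc hz0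
  obtain ⟨P', Q', hQ', hPQ'⟩ := E.exists_int_frac_formalVariableChange_subst vc hz0 hQ hPQ hQ₂ hPQ₂
  obtain ⟨P₂', Q₂', hQ₂', hPQ₂'⟩ := E.exists_int_frac_formalW_smul_subst vc hz0 hQ hPQ hQ₂ hPQ₂
  rw [← ht₀] at hPQ'
  rw [hC, ← ht₀] at hPQ₂'
  exact ⟨t₀, ht₀0, ht₀1, hlog₀, P', Q', P₂', Q₂', hQ', hPQ', hQ₂', hPQ₂'⟩

end Summit.BirchSwinnertonDyer.BirchSwinnertonDyer.Theorems.ManinLocalTwoThree.StevensIntegrality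

end
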